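import Summits.QuantumFields.BalabanUV.T4Continuum.Support.ShellMeasureRootCompositionHistories
import Literature.MathematicalPhysics.QuantumFieldTheory.Balaban1983to89.T4ShellMeasureDet
import Literature.MathematicalPhysics.QuantumFieldTheory.Balaban1983to89.T4AveragingDisintegration

/-!
# `T4Continuum.ShellMeasureHistoriesTransport` — THE ONE CALL ON THE HISTORIES ROAD NEEDS A TRANSPORT: (M1) for a
# history's law on the comparison's COMMON sample space from (M1) on the slot's OWN layer, read through a measurable map
(cell `pub-balaban`, sub-cell `t4`, spine estimate NE7c (node U5b); NE7c ROUND-2 crew, unit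
`b2b-balaban-t4-ne7c-formalise-leaf-08` gen 16; owner table `t4/b2b-balaban-t4-ne7c-p1/LEAVES-NE7c-P1.md` row **S103a
«HISTORIES TRANSPORT»** (owner GO R-ne7cp1-g35-6, journal `CLAIMS.log` l.20881) = the KERNEL HALF of this seat's feasibility
word A-ne7cleaf08-g16-1 (l.20778) on the owner's question Q-ne7cp1-g35-1 «CANDIDATE ROW S103 — THE ONE CALL ON THE HISTORIES
ROAD» (row S103b, to follow S102, consumes this file BY NAME); ADDITIVE — imports S24 `ShellMeasureRootCompositionHistories` (`histLaw`, `partialLaw`,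
`slotAntiConcentration_finsetSum`), the Literature transport `T4ShellMeasureDet` (`slotAntiConcentration_comap`) and the
cell's disintegration vocabulary `T4AveragingDisintegration` (`kernelTransport`) ONLY; [folklore] measure theory; 0 `def`,
0 `def … : Prop`, 0 sorry, 0 citation tags)

HONEST FRAMING.  Finite four-torus programme, rung (B)+1 only — NOT infinite volume, NOT a mass gap, NOT the Clay problem,
NOT summit progress; (B), `BetaPertHyp`, (B^μ) not consumed.  NE7c (`T4IndicatorShell.ShellWeightBound`) is NOT PRINTED and
NOT PROVED; «NE7c ⇐ the named binders» (c3).  STRUCTURAL BOOKKEEPING on OUR side only: (M1) is a statement about two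
masses of ONE measure, so it travels along a measurable map between the comparison's common space and a slot's layer; no
estimate of Bałaban's is touched, asserted or discharged; NOTHING in the countdown moves.  HONEST DEPENDENCY (cell):
continuum YM on T⁴ ⇐ BetaPertH ∧ nine spine estimates (0/9 proved); BetaPertH ⇐ (D1) ∧ (D4) ∧ CAP+tail; G-an2-4 gates asym,
D1 and NE2/3/4.

THE TYPE POINT (A-ne7cleaf08-g16-1 (O1)).  The histories-road END-I (S24 `shellWeightBound_histories_age`, S93 §2) is typed
over ONE sample space `Ω K` per comparison `K`, shared by both runs and all slots ∕ histories (the two-run a.e. closeness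
compares the runs at the same `ω`), while END-II (S80 f6 ∕ S99 f3b) concludes (M1) for
`(fieldMeasure (P r K s) (jl r K s) SU2).withDensity F` on the slot's OWN layer, which varies with `(r, s)`.  So «one
dictionary identity `(fieldMeasure …).withDensity F = histLaw (ν τ) …` per history» type-checks only for single-level
histories.  The repair is a TRANSPORT: the slot variable on `Ω K` is READ THROUGH a measurable map to the layer,
`u s = u' ∘ π` (B14 (2.16) TYPE — the localized minimiser read off the current configuration; a [dict] sentence, class O,
nothing asserted), and (M1) pulls back along `π` (`T4ShellMeasureDet` ∕ `T4ShellMeasureFibre.slotAntiConcentration_comap`).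

CONTENT.
* §1 `histLaw_withDensity` — a history's law over a TILTED reference is the reference tilted by the product:
  `histLaw (μ.withDensity H) sm u ϑ = μ.withDensity (H · ofReal ∘ smallProd)` (`MeasureTheory.withDensity_mul`).
* §2 `slotAntiConcentration_histLaw_of_layer` — (M1) for `histLaw ν sm u ϑ` along `u s` ⇐ (M1) for ANY measure `μ'` on the
  layer along `u'`, given `π` measurable, the reading `u s = u' ∘ π` and the identification `(histLaw …).map π = μ'`.
* §3 `slotAntiConcentration_partialLaw_of_layers` — the `s`-small PARTIAL LAW (S24 `partialLaw`, a finite sum over the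
  histories in which `s` is live-small): per history a layer measure, an identification and (M1) on the layer ⟹ (M1) for the
  partial law along `u s`, SAME `θ ρ D` (`slotAntiConcentration_finsetSum`) — LITERALLY the shape of S93 §2's `hacA`∕`hacB`
  at one `(K, t, s)`; §3b `hac_histories_of_layers` — the `(K, t)`-indexed family in S93's binder shape.
* §4 `map_withDensity_eq_withDensity_kernelTransport` — FOR ONE AVERAGING STEP the identification of §2 is KERNEL under
  absolute continuity of the image law (`T4FiniteEpsInhabited.HaarAC` TYPE, `ν.map avg ≪ μ`): the image of a tilted fine law
  `(ν.withDensity (ofReal ∘ ρ)).map avg` IS the coarse reference tilted by the cell's `kernelTransport ν μ avg ρ`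
  (`T4AveragingDisintegration.integral_kernelTransport_mul` tested on indicators) — so the [dict] content of the transport is
  the READING `u s = u' ∘ π` alone, not the measure identity.
NOT HERE: which `π` (iterated block averaging of [Balaban1985Averaging] (0.4) TYPE), which `H τ` (the history's sectioned
density, B14 (2.18) TYPE) — node O's dictionary; no END is re-fired (that is row S103's, if booked).
-/

noncomputable section

open MeasureTheory Finset Set

namespace Summit.QuantumFields.BalabanUV.T4Continuum.ShellMeasureHistoriesTransport

open scoped ENNReal
open Literature.MathematicalPhysics.QuantumFieldTheory.Balaban1983to89
open T4ShellMeasure (SlotAntiConcentration)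
open T4ShellMeasureFibre (slotAntiConcentration_comap)
open T4AveragingDisintegration (kernelTransport kernelTransport_nonneg integrable_kernelTransport
  integral_kernelTransport_mul)
open ShellMeasureRootCompositionHistories (smallProd measurable_smallProd smallProd_nonneg histLaw partialLaw
  slotAntiConcentration_finsetSum)

/-! ## §1 A history's law over a tilted reference -/

section Tilted

variable {Ω σ : Type*} [MeasurableSpace Ω] [DecidableEq σ]

omit [DecidableEq σ] in
/-- **THE HISTORY'S LAW OVER A TILTED REFERENCE IS THE REFERENCE TILTED BY THE PRODUCT**:
`histLaw (μ.withDensity H) sm u ϑ = μ.withDensity (ω ↦ H ω · ofReal (smallProd sm u ϑ ω))` for a measurable density `H` and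
measurable tested variables (`MeasureTheory.withDensity_mul`). [folklore] -/
theorem histLaw_withDensity (μ : Measure Ω) {H : Ω → ℝ≥0∞} (hH : Measurable H) (sm : Finset σ) {u : σ → Ω → ℝ}
    (hu : ∀ s, Measurable (u s)) (ϑ : σ → ℝ) :
    histLaw (μ.withDensity H) sm u ϑ = μ.withDensity (fun ω => H ω * ENNReal.ofReal (smallProd sm u ϑ ω)) := by
  unfold histLaw
  exact (withDensity_mul μ hH (ENNReal.measurable_ofReal.comp (measurable_smallProd sm hu ϑ))).symm

omit [DecidableEq σ] in
/-- the untilted case: `histLaw μ sm u ϑ` is `μ` tilted by `ofReal ∘ smallProd` (the definition, for reference). [folklore] -/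
theorem histLaw_eq_withDensity (μ : Measure Ω) (sm : Finset σ) (u : σ → Ω → ℝ) (ϑ : σ → ℝ) :
    histLaw μ sm u ϑ = μ.withDensity (fun ω => ENNReal.ofReal (smallProd sm u ϑ ω)) := rfl

end Tilted

/-! ## §2 (M1) for ONE history's law from (M1) on the slot's layer, read through a measurable map -/

section OneHistory

variable {Ω Ω' σ : Type*} [MeasurableSpace Ω] [MeasurableSpace Ω'] [DecidableEq σ]

omit [DecidableEq σ] in
/-- **(M1) FOR A HISTORY'S LAW ON THE COMMON SPACE FROM (M1) ON THE SLOT'S LAYER.**  Data: the history's law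
`histLaw ν sm u ϑ` on the comparison's common space `Ω`; the slot's layer `Ω'` with a measure `μ'` and a tested variable `u'`;
a measurable map `π : Ω → Ω'`.  Hypotheses: the READING `u s = u' ∘ π` ([dict], B14 (2.16) TYPE: the slot's variable is its
layer variable read off the current configuration), the IDENTIFICATION `(histLaw ν sm u ϑ).map π = μ'` (§4: kernel for one
averaging step under `HaarAC`; in general node O's), and (M1) for `μ'` along `u'` (END-II's conclusion when
`μ' = (fieldMeasure P j SU2).withDensity F`).  Conclusion: (M1) for the history's law along `u s`, SAME `θ ρ D`. [folklore] -/
theorem slotAntiConcentration_histLaw_of_layer {ν : Measure Ω} {sm : Finset σ} {u : σ → Ω → ℝ} {ϑ : σ → ℝ} {s : σ}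
    {π : Ω → Ω'} (hπ : Measurable π) {u' : Ω' → ℝ} (hread : u s = u' ∘ π) {μ' : Measure Ω'}
    (hid : (histLaw ν sm u ϑ).map π = μ') {θ ρ D : ℝ} (h : SlotAntiConcentration μ' u' θ ρ D) :
    SlotAntiConcentration (histLaw ν sm u ϑ) (u s) θ ρ D := by
  rw [hread]
  rw [← hid] at h
  exact slotAntiConcentration_comap hπ h

omit [DecidableEq σ] in
/-- the same for ANY measure on the common space (not necessarily a history's law) — the bare transport. [folklore] -/
theorem slotAntiConcentration_of_layer {μ : Measure Ω} {v : Ω → ℝ} {π : Ω → Ω'} (hπ : Measurable π) {u' : Ω' → ℝ}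
    (hread : v = u' ∘ π) {μ' : Measure Ω'} (hid : μ.map π = μ') {θ ρ D : ℝ} (h : SlotAntiConcentration μ' u' θ ρ D) :
    SlotAntiConcentration μ v θ ρ D := by
  rw [hread]
  rw [← hid] at h
  exact slotAntiConcentration_comap hπ h

end OneHistory

/-! ## §3 (M1) for the `s`-small PARTIAL LAW from per-history layer data — S93 §2's `hacA`∕`hacB` shape -/

section PartialLaw

variable {Ω σ ι : Type*} [MeasurableSpace Ω] [DecidableEq σ]

/-- **(M1) FOR THE `s`-SMALL PARTIAL LAW FROM THE SLOT'S LAYER, HISTORY BY HISTORY.**  For a slot `s` with layer `Ω'`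
(measurable space), layer variable `u'` and reading map `π` (`u s = u' ∘ π`): if for every history `τ ∈ T` in which `s`
is live-small the image law `(histLaw (ν τ) (small τ) u ϑ).map π` is identified with a layer measure `μ' τ` satisfying (M1)
along `u'` with the SAME `θ ρ D`, then the partial law `partialLaw T ν small u ϑ s` satisfies (M1) along `u s` with that
`θ ρ D` (finite additivity, S24 `slotAntiConcentration_finsetSum`). [folklore] -/
theorem slotAntiConcentration_partialLaw_of_layers {Ω' : Type*} [MeasurableSpace Ω'] (T : Finset ι)
    (ν : ι → Measure Ω) (small : ι → Finset σ) (u : σ → Ω → ℝ) (ϑ : σ → ℝ) (s : σ) {π : Ω → Ω'}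
    (hπ : Measurable π) {u' : Ω' → ℝ} (hread : u s = u' ∘ π) (μ' : ι → Measure Ω')
    (hid : ∀ τ ∈ T, s ∈ small τ → (histLaw (ν τ) (small τ) u ϑ).map π = μ' τ) {θ ρ D : ℝ}
    (h : ∀ τ ∈ T, s ∈ small τ → SlotAntiConcentration (μ' τ) u' θ ρ D) :
    SlotAntiConcentration (partialLaw T ν small u ϑ s) (u s) θ ρ D := by
  unfold partialLaw
  refine slotAntiConcentration_finsetSum _ _ fun τ hτ => ?_
  rw [Finset.mem_filter] at hτ
  exact slotAntiConcentration_histLaw_of_layer hπ hread (hid τ hτ.1 hτ.2) (h τ hτ.1 hτ.2)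

end PartialLaw

/-! ## §3b The `(K, t)`-indexed family: S93 §2's binder `hacA` LITERALLY, from layer data per slot -/

section Family

variable {Ω : ℕ → Type*} [∀ K, MeasurableSpace (Ω K)] {σ ι : Type*} [DecidableEq σ]

/-- **S93 §2's `hacA`∕`hacB` FROM THE LAYERS.**  Slot layers `Lay K s` (measurable spaces) with reading maps
`π K s : Ω K → Lay K s` and layer variables `u' K t s`; per `(K, t, s, τ)` a layer measure `μ' K t s τ` identified with
the image of the history's law and satisfying (M1) with the slot's threshold `ε (K − lvl K s)`, width `ρ (lvl K s)` and
constant `D (lvl K s)` ⟹ the histories-road END-I's per-slot binder, in its own shape: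
`∀ K t, |t| ≤ l₀ → ∀ s ∈ C K, SlotAntiConcentration (partialLaw (T K) (ν K t) (small K) (u K t) (ε ∘ age) s) (u K t s) …`.
Nothing of Bałaban's is instantiated; `π`, `μ'` and the identifications are the consumer's (node O ∕ §4). [folklore] -/
theorem hac_histories_of_layers {T : ℕ → Finset ι} {C : ℕ → Finset σ} {small : ℕ → ι → Finset σ} {lvl : ℕ → σ → ℕ}
    {ν : ∀ K : ℕ, ℝ → ι → Measure (Ω K)} {u : ∀ K : ℕ, ℝ → σ → Ω K → ℝ} {ε : ℕ → ℝ} {ρ D : ℕ → ℝ} {l₀ : ℝ}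
    {Lay : ℕ → σ → Type*} [∀ K s, MeasurableSpace (Lay K s)] {π : ∀ K s, Ω K → Lay K s}
    (hπ : ∀ K s, Measurable (π K s)) {u' : ∀ K (t : ℝ) s, Lay K s → ℝ}
    (hread : ∀ K t, |t| ≤ l₀ → ∀ s ∈ C K, u K t s = u' K t s ∘ π K s)
    (μ' : ∀ K (t : ℝ) s, ι → Measure (Lay K s))
    (hid : ∀ K t, |t| ≤ l₀ → ∀ s ∈ C K, ∀ τ ∈ T K, s ∈ small K τ →
      (histLaw (ν K t τ) (small K τ) (u K t) (fun s' => ε (K - lvl K s'))).map (π K s) = μ' K t s τ)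
    (hlay : ∀ K t, |t| ≤ l₀ → ∀ s ∈ C K, ∀ τ ∈ T K, s ∈ small K τ →
      SlotAntiConcentration (μ' K t s τ) (u' K t s) (ε (K - lvl K s)) (ρ (lvl K s)) (D (lvl K s))) :
    ∀ K t, |t| ≤ l₀ → ∀ s ∈ C K,
      SlotAntiConcentration (partialLaw (T K) (ν K t) (small K) (u K t) (fun s' => ε (K - lvl K s')) s) (u K t s)
        (ε (K - lvl K s)) (ρ (lvl K s)) (D (lvl K s)) :=
  fun K t ht s hs =>
    slotAntiConcentration_partialLaw_of_layers (T K) (ν K t) (small K) (u K t) _ s (hπ K s) (hread K t ht s hs)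
      (μ' K t s) (hid K t ht s hs) (hlay K t ht s hs)

end Family

/-! ## §4 One averaging step: the identification of §2 is KERNEL under absolute continuity of the image law -/

section OneStep

variable {α β : Type*} [MeasurableSpace α] [MeasurableSpace β] [StandardBorelSpace β] [Nonempty β]

/-- **THE IMAGE OF A TILTED FINE LAW UNDER ONE AVERAGING IS THE COARSE REFERENCE TILTED BY THE KERNEL TRANSPORT.**  For a
finite fine reference `ν`, a σ-finite coarse reference `μ`, a measurable `avg : β → α` with `ν.map avg ≪ μ` (the cell's
`HaarAC` TYPE) and a nonnegative `ν`-integrable density `ρ`: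
`(ν.withDensity (ofReal ∘ ρ)).map avg = μ.withDensity (ofReal ∘ kernelTransport ν μ avg ρ)` — the measure form of
`T4AveragingDisintegration.integral_kernelTransport_mul` (tested on indicators).  Hence, at ONE averaging step, §2's
identification `hid` is a THEOREM and only the reading `u s = u' ∘ avg` is a dictionary sentence. [folklore] -/
theorem map_withDensity_eq_withDensity_kernelTransport (ν : Measure β) [IsFiniteMeasure ν] (μ : Measure α)
    [SigmaFinite μ] {avg : β → α} (havg : Measurable avg) (hac : ν.map avg ≪ μ) {ρ : β → ℝ} (hρ : Integrable ρ ν)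
    (h0 : ∀ U, 0 ≤ ρ U) :
    (ν.withDensity fun U => ENNReal.ofReal (ρ U)).map avg =
      μ.withDensity fun V => ENNReal.ofReal (kernelTransport ν μ avg ρ V) := by
  have hT0 : ∀ V, 0 ≤ kernelTransport ν μ avg ρ V := kernelTransport_nonneg h0
  have hTi : Integrable (kernelTransport ν μ avg ρ) μ := integrable_kernelTransport ν μ havg hac hρ
  ext S hS
  rw [Measure.map_apply havg hS, withDensity_apply _ (havg hS), withDensity_apply _ hS]
  -- both sides are `ofReal` of a real integral of a nonnegative integrable function against an indicator
  have hind : Measurable (S.indicator fun _ => (1 : ℝ)) := measurable_const.indicator hS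
  have key := integral_kernelTransport_mul ν μ havg hac hρ hind (C := 1)
    (fun V => by by_cases hV : V ∈ S <;> simp [hV])
  -- rewrite the two products as indicators
  have e1 : (fun V => kernelTransport ν μ avg ρ V * S.indicator (fun _ => (1 : ℝ)) V) =
      S.indicator (kernelTransport ν μ avg ρ) := by
    funext V; by_cases hV : V ∈ S <;> simp [hV]
  have e2 : (fun U => ρ U * S.indicator (fun _ => (1 : ℝ)) (avg U)) = (avg ⁻¹' S).indicator ρ := by
    funext U; by_cases hU : U ∈ avg ⁻¹' S
    · have : avg U ∈ S := hU
      simp [hU, this]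
    · have : avg U ∉ S := hU
      simp [hU, this]
  rw [e1, e2, integral_indicator hS, integral_indicator (havg hS)] at key
  -- pass to `lintegral` through `ofReal_integral_eq_lintegral_ofReal` on the restricted measures
  have hL : ENNReal.ofReal (∫ V in S, kernelTransport ν μ avg ρ V ∂μ) =
      ∫⁻ V in S, ENNReal.ofReal (kernelTransport ν μ avg ρ V) ∂μ :=
    ofReal_integral_eq_lintegral_ofReal hTi.integrableOn (ae_of_all _ fun V => hT0 V)
  have hR : ENNReal.ofReal (∫ U in avg ⁻¹' S, ρ U ∂ν) = ∫⁻ U in avg ⁻¹' S, ENNReal.ofReal (ρ U) ∂ν :=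
    ofReal_integral_eq_lintegral_ofReal hρ.integrableOn (ae_of_all _ fun U => h0 U)
  rw [← hR, ← hL, key]

/-- **COROLLARY — (M1) PULLS BACK THROUGH ONE AVERAGING STEP WITH NO IDENTIFICATION HYPOTHESIS**: if the coarse law
`μ.withDensity (ofReal ∘ kernelTransport ν μ avg ρ)` satisfies (M1) along `u'`, then the tilted fine law
`ν.withDensity (ofReal ∘ ρ)` satisfies (M1) along `u' ∘ avg`, SAME `θ ρ' D`. [folklore] -/
theorem slotAntiConcentration_of_oneStep (ν : Measure β) [IsFiniteMeasure ν] (μ : Measure α) [SigmaFinite μ]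
    {avg : β → α} (havg : Measurable avg) (hac : ν.map avg ≪ μ) {ρ : β → ℝ} (hρ : Integrable ρ ν) (h0 : ∀ U, 0 ≤ ρ U)
    {u' : α → ℝ} {θ ρ' D : ℝ}
    (h : SlotAntiConcentration (μ.withDensity fun V => ENNReal.ofReal (kernelTransport ν μ avg ρ V)) u' θ ρ' D) :
    SlotAntiConcentration (ν.withDensity fun U => ENNReal.ofReal (ρ U)) (u' ∘ avg) θ ρ' D :=
  slotAntiConcentration_of_layer havg rfl (map_withDensity_eq_withDensity_kernelTransport ν μ havg hac hρ h0) h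

end OneStep

/-! ## §3c (v1.1, APPEND-ONLY) The `(K, t)`-indexed family in the FINE currency of the histories END-I OF RECORD (S93 §3)

XREAD C-ne7cleaf03g8-3 (leaf-03-g8, journal `CLAIMS.log` l.21192) DOCFIX-LOW-1: §3b's profile `fun s' => ε (K − lvl K s')` is the
threshold-units `hacA` of S24 `shellWeightBound_histories_age` ∕ S90 f3 `ShellMeasureThresholdUnitsHistories`; the histories END-I
OF RECORD S93 `ShellMeasureRootCompositionHistoriesFine.shellWeightBound_histories_fine_of_localRate` (D-ne7cp1-g33-1) carries the
FINE profile `fun s' => ε (K − lvl K s') * ηA K s' ^ 2` for the RAW variables.  §3 is profile-generic; this is its fine instance,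
so that S103b feeds S93 §3 in one line.  Nothing above is changed. -/

section FamilyFine

variable {Ω : ℕ → Type*} [∀ K, MeasurableSpace (Ω K)] {σ ι : Type*} [DecidableEq σ]

/-- **S93 §3's FINE-CURRENCY `hacA`∕`hacB` FROM THE LAYERS** (v1.1): as `hac_histories_of_layers`, for RAW slot variables
`v K t s` with positive-or-not fine scales `ηr K s` (run-specific), profile `fun s' => ε (K − lvl K s') * ηr K s' ^ 2` and
threshold `ε (K − lvl K s) * ηr K s ^ 2` — LITERALLY the per-slot binder of
`ShellMeasureRootCompositionHistoriesFine.shellWeightBound_histories_fine_of_localRate` (with `ρ := geomWidth …`, `D := DA`);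
the layer side (reading maps `π K s`, layer variables `u'`, layer measures `μ'`, identifications, (M1) on the layer at the
fine threshold) exactly as in §3b. [folklore] -/
theorem hac_histories_fine_of_layers {T : ℕ → Finset ι} {C : ℕ → Finset σ} {small : ℕ → ι → Finset σ} {lvl : ℕ → σ → ℕ}
    {ν : ∀ K : ℕ, ℝ → ι → Measure (Ω K)} {v : ∀ K : ℕ, ℝ → σ → Ω K → ℝ} {ε : ℕ → ℝ} {ηr : ℕ → σ → ℝ} {ρ D : ℕ → ℝ}
    {l₀ : ℝ} {Lay : ℕ → σ → Type*} [∀ K s, MeasurableSpace (Lay K s)] {π : ∀ K s, Ω K → Lay K s}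
    (hπ : ∀ K s, Measurable (π K s)) {u' : ∀ K (t : ℝ) s, Lay K s → ℝ}
    (hread : ∀ K t, |t| ≤ l₀ → ∀ s ∈ C K, v K t s = u' K t s ∘ π K s)
    (μ' : ∀ K (t : ℝ) s, ι → Measure (Lay K s))
    (hid : ∀ K t, |t| ≤ l₀ → ∀ s ∈ C K, ∀ τ ∈ T K, s ∈ small K τ →
      (histLaw (ν K t τ) (small K τ) (v K t) (fun s' => ε (K - lvl K s') * ηr K s' ^ 2)).map (π K s) = μ' K t s τ)
    (hlay : ∀ K t, |t| ≤ l₀ → ∀ s ∈ C K, ∀ τ ∈ T K, s ∈ small K τ →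
      SlotAntiConcentration (μ' K t s τ) (u' K t s) (ε (K - lvl K s) * ηr K s ^ 2) (ρ (lvl K s)) (D (lvl K s))) :
    ∀ K t, |t| ≤ l₀ → ∀ s ∈ C K,
      SlotAntiConcentration
        (partialLaw (T K) (ν K t) (small K) (v K t) (fun s' => ε (K - lvl K s') * ηr K s' ^ 2) s) (v K t s)
        (ε (K - lvl K s) * ηr K s ^ 2) (ρ (lvl K s)) (D (lvl K s)) :=
  fun K t ht s hs =>
    slotAntiConcentration_partialLaw_of_layers (T K) (ν K t) (small K) (v K t) _ s (hπ K s) (hread K t ht s hs)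
      (μ' K t s) (hid K t ht s hs) (hlay K t ht s hs)

end FamilyFine

end Summit.QuantumFields.BalabanUV.T4Continuum.ShellMeasureHistoriesTransport

end
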